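import Summits.AtomisticToContinuum.Crystallization.Theorems.FrustratedLawDichotomyCollarCensusTight
import Summits.AtomisticToContinuum.Crystallization.Theorems.FrustratedLawDichotomyCollarCensusUnionSharp

/-!
# FrustratedLawDichotomy · cruxes `AperiodicFrustratedLawGap` / `PeriodicFrustratedLawGap` (stmt-AtomisticToContinuum-27623 / 27624) — the
# ZERO-TOLERANCE move exemption: a direct μGSC door for the sharp one-atom move test at `ε = 0` (decomp-a2c, prover hand 2, generation 18;
# critic row 643 asked whether the apex admits `ε = 0`; answer: not through `…ExemptLocOpt.deepAbsent_locOptFails` (its window-tail depth is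
# `∝ 1/ε`), but through THIS door, which compares the move against the INFINITE ground state and pays the far field with the dipole allowance)

The leaf lines of `…CollarCensusUnion/…Tight` certify the motif exemption against the WINDOW-local optimality `LocOptFails e⋆ ε ϱ′ 1`, whose deep
absence needs `ε > 0` (the window's far field enters with either sign).  For the MOVE test this detour is unnecessary: if a deep window site `x`
of a rooted `7/10`-separated `e⋆`-μGSC `X` had a trial move `p` (`|p − x| ≤ s < 7/10 ≤ … `, `1 + s ≤ Rm`) with
`E_loc(p) + σ(s) < E_loc(x)` (local sums over the atoms of `X` within `Rm` of `x`, all inside the window once the depth is `≥ Rm`), then Sütő's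
inequality for `X ∖ {x} ∪ {p}` (`IsMuGSC`: `I(x, X∖x) ≤ I(p, X∖x)`) would be violated, because the far part `Σ_{y ∈ X, |y − x| > Rm}
[V(|p − y|) − V(|x − y|)]` is at most the dipole allowance `σ(s) = s·(Rm/(Rm−s))⁷·S₇♯(Rm)` (`…ExemptMoveDipole.abs_lennardJones_move_sub_le`
summed with `…FarFieldSharp.sum_inv_pow_le_of_separated_sharp` over the infinite separated set).  So the union-over-steps move flag AT `ε = 0` is
deep-absent at depth `Rm` (§2 `deepAbsent_moveUnstableCore_union_zero`) — no tolerance at all on the T-side move test; the removal test and the E-side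
keep their positive tolerances `t`, `ε_E` (their doors are unchanged).

* §1 `tsum_far_move_sub_le` — the dipole allowance over an infinite `7/10`-separated far set;
* §2 ★★ `deepAbsent_moveUnstableCore_union_zero`;
* §3 the cluster exemption `Ex₀ := sharp-move₀ ∨ LocOptFails e⋆ ε_E ϱ′ 1` (deep-absent by `DeepAbsent.or`), the E-side hypothesis transported to it
  (`schurElasticPricingX_mono_ex`), and the two-slot transfer of the motif predicate `ExM∪T₀ := (∃ s ∈ [0,S], NonEquilibriumCore eUp 0 Rm s t) ∨ capped-tight`;
* §4 ★★★ the leaf `aperiodicFrustratedLawGap_of_collarPiecesKK_milli_unionT_zero` (+ periodic): T-side move tolerance `0`, E-side tolerance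
  `ε_E ∈ (0, 10⁻⁴]` free — the `ε → 0⁺` endpoint of the line of record `…Tight.…_milli_unionT_eps` made exact (union-clean force cap `σ′(7) ≈ 0.0108`),
  and the transfer from every member of the ε-family (`collarPiecesKK_unionT_zero_of_eps`).
All `[folklore]`; 0 sorry; no definitions.
-/

noncomputable section

namespace Summit.AtomisticToContinuum.Crystallization.Theorems.FrustratedLawDichotomyCollarCensusZero

open scoped BigOperators Classical
open Metric
open Literature.MathematicalPhysics.StatisticalMechanics (lennardJones interactionEnergy IsMuGSC)
open Summit.AtomisticToContinuum.Crystallization.Theorems.ChargedEnergyGapNegative (E3 eStar)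
open Summit.AtomisticToContinuum.Crystallization.Theorems.FrustratedLawDichotomyRangeCut
open Summit.AtomisticToContinuum.Crystallization.Theorems.FrustratedLawDichotomySchurCut
open Summit.AtomisticToContinuum.Crystallization.Theorems.FrustratedLawDichotomyMotifLemmas
open Summit.AtomisticToContinuum.Crystallization.Theorems.FrustratedLawDichotomyRuleToolkit (IsLocalFeature)
open Summit.AtomisticToContinuum.Crystallization.Theorems.FrustratedLawDichotomyGSCClusterExactness (summable_of_subset)
open Summit.AtomisticToContinuum.Crystallization.Theorems.FrustratedLawDichotomyAveragingCut
  (ball ballAvg mem_ball Mball one_le_Mball Dfl Dfl_pos CT₀ Dfl_le_CT₀ CT₄₅ W₄₅_cutBounds CutBounds)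
open Summit.AtomisticToContinuum.Crystallization.Theorems.FrustratedLawDichotomyAveragingRule
open Summit.AtomisticToContinuum.Crystallization.Theorems.FrustratedLawDichotomyAveragingRuleCap
open Summit.AtomisticToContinuum.Crystallization.Theorems.FrustratedLawDichotomyExemptDoor (SitePred DeepAbsent DeepAbsent.or DeepAbsent.mono)
open Summit.AtomisticToContinuum.Crystallization.Theorems.FrustratedLawDichotomyExemptLocOpt (LocOptFails deepAbsent_locOptFails tsum_sdiff_split)
open Summit.AtomisticToContinuum.Crystallization.Theorems.FrustratedLawDichotomyExemptSplit
  (SchurTopologicalPricingX SchurElasticPricingX aperiodicFrustratedLawGap_of_splitX periodicFrustratedLawGap_of_splitX)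
open Summit.AtomisticToContinuum.Crystallization.Theorems.FrustratedLawDichotomyExemptMove (tsum_range_ball_diff_singleton_eq interactionEnergy_fin_one)
open Summit.AtomisticToContinuum.Crystallization.Theorems.FrustratedLawDichotomyExemptMoveDipole (abs_lennardJones_move_sub_le)
open Summit.AtomisticToContinuum.Crystallization.Theorems.FrustratedLawDichotomyFarFieldSharp (sum_inv_pow_le_of_separated_sharp)
open Summit.AtomisticToContinuum.Crystallization.Theorems.FrustratedLawDichotomyBumpAutocorrelation (sf₄₅_holds)
open Summit.AtomisticToContinuum.Crystallization.Theorems.FrustratedLawDichotomyExemptAbsorption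
open Summit.AtomisticToContinuum.Crystallization.Theorems.FrustratedLawDichotomyExemptAbsorptionRecord
open Summit.AtomisticToContinuum.Crystallization.Theorems.FrustratedLawDichotomyCollarCensus
open Summit.AtomisticToContinuum.Crystallization.Theorems.FrustratedLawDichotomyCollarCensusKappa
open Summit.AtomisticToContinuum.Crystallization.Theorems.FrustratedLawDichotomyCollarCensusUnion
open Summit.AtomisticToContinuum.Crystallization.Theorems.FrustratedLawDichotomyCollarCensusTight
open Summit.AtomisticToContinuum.Crystallization.Theorems.GrainCoreNetworkSplitMuEquilibriumDoor (muEquilibriumDoor)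

/-! ## §1. The dipole allowance over an infinite separated far set -/

/-- ★ **Dipole allowance over an INFINITE far set**: `X` `7/10`-separated with summable fields, `B ⊆ X` at distance `≥ Rm` from `x`, `|p − x| ≤ s`,
`1 + s ≤ Rm` ⟹ `Σ'_{y ∈ B} [V_LJ(|p − y|) − V_LJ(|x − y|)] ≤ s·(Rm/(Rm − s))⁷·S₇♯(Rm)`. [folklore] -/
theorem tsum_far_move_sub_le {X B : Set E3} (hsep : ∀ a ∈ X, ∀ b ∈ X, a ≠ b → (7 : ℝ) / 10 ≤ dist a b)
    (hsum : ∀ r : E3, Summable fun y : ↥X => lennardJones (dist r y)) (hBX : B ⊆ X) {x p : E3} {s Rm : ℝ} (hps : dist p x ≤ s)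
    (hRm : 1 + s ≤ Rm) (hfar : ∀ y ∈ B, Rm ≤ dist y x) :
    ∑' y : ↥B, (lennardJones (dist p y) - lennardJones (dist x y)) ≤
      s * (Rm / (Rm - s)) ^ 7 * (6000 / 343 * Rm⁻¹ ^ 4 + 2880 / 49 * Rm⁻¹ ^ 5 + 10 / 7 * Rm⁻¹ ^ 6 + 2 * Rm⁻¹ ^ 7) := by
  classical
  have hs0 : 0 ≤ s := dist_nonneg.trans hps
  have hRs : 0 < Rm - s := by linarith
  have hc : 0 ≤ s * (Rm / (Rm - s)) ^ 7 := mul_nonneg hs0 (pow_nonneg (div_nonneg (by linarith) hRs.le) 7)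
  have h1 : Summable fun y : ↥B => lennardJones (dist p y) :=
    summable_of_subset (f := fun y => lennardJones (dist p y)) (hsum p) hBX
  have h2 : Summable fun y : ↥B => lennardJones (dist x y) :=
    summable_of_subset (f := fun y => lennardJones (dist x y)) (hsum x) hBX
  refine (h1.sub h2).tsum_le_of_sum_le fun u => ?_
  set u' : Finset E3 := u.image Subtype.val with hu'
  have hmem : ∀ y ∈ u', y ∈ B := fun y hy => by
    rw [hu', Finset.mem_image] at hy
    obtain ⟨w, -, rfl⟩ := hy
    exact w.2
  have hsum_eq : ∑ y ∈ u, (lennardJones (dist p y) - lennardJones (dist x y)) =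
      ∑ y ∈ u', (lennardJones (dist p y) - lennardJones (dist x y)) := by
    rw [hu', Finset.sum_image (fun a _ b _ h => Subtype.ext h)]
  rw [hsum_eq]
  have hsep' : ∀ a ∈ u', ∀ b ∈ u', a ≠ b → (7 : ℝ) / 10 ≤ dist a b :=
    fun a ha b hb hab => hsep a (hBX (hmem a ha)) b (hBX (hmem b hb)) hab
  have hfar' : ∀ y ∈ u', Rm ≤ dist y x := fun y hy => hfar y (hmem y hy)
  have hterm : ∀ y ∈ u', lennardJones (dist p y) - lennardJones (dist x y) ≤ s * (Rm / (Rm - s)) ^ 7 * (dist y x)⁻¹ ^ 7 :=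
    fun y hy => (le_abs_self _).trans (abs_lennardJones_move_sub_le hps hRm (hfar' y hy))
  have hpack := sum_inv_pow_le_of_separated_sharp u' x (k := 4) (by norm_num) (by norm_num : (0 : ℝ) < 7 / 10) (by linarith) hsep' hfar'
  calc ∑ y ∈ u', (lennardJones (dist p y) - lennardJones (dist x y))
      ≤ ∑ y ∈ u', s * (Rm / (Rm - s)) ^ 7 * (dist y x)⁻¹ ^ 7 := Finset.sum_le_sum hterm
    _ = s * (Rm / (Rm - s)) ^ 7 * ∑ y ∈ u', (dist y x)⁻¹ ^ 7 := by rw [Finset.mul_sum]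
    _ ≤ s * (Rm / (Rm - s)) ^ 7 * (6000 / 343 * Rm⁻¹ ^ 4 + 2880 / 49 * Rm⁻¹ ^ 5 + 10 / 7 * Rm⁻¹ ^ 6 + 2 * Rm⁻¹ ^ 7) := by
        refine mul_le_mul_of_nonneg_left (hpack.trans (le_of_eq ?_)) hc
        norm_num

/-! ## §2. The zero-tolerance move flag is deep-absent -/

/-- ★★ **THE ZERO-TOLERANCE MOVE DOOR**: for `1 + S ≤ Rm`, the union-over-steps move flag AT `ε = 0`,
`∃ s ∈ [0, S], MoveUnstableCore 0 Rm s`, is deep-absent at depth `Rm`: no site of a rooted `7/10`-separated `e⋆`-μGSC deeper than `Rm` inside a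
window has a trial move `p` (`|p − x| ≤ s`, `|p − x| < 7/10`) with `E_loc(p) + σ(s) < E_loc(x)` — Sütő's inequality against the INFINITE
configuration, the far field paid by the dipole allowance (§1). [folklore] -/
theorem deepAbsent_moveUnstableCore_union_zero {Rm S : ℝ} (hRmS : 1 + S ≤ Rm) :
    DeepAbsent Rm (fun N y j => ∃ s : ℝ, 0 ≤ s ∧ s ≤ S ∧ MoveUnstableCore 0 Rm s N y j) := by
  classical
  intro X _ hsep hGSC r n xf hinj hrange j hj hflag
  obtain ⟨s, hs0, hsS, p, hps, hp7, hlt⟩ := hflag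
  have hRm1 : 1 + s ≤ Rm := by linarith
  have hRm0 : 0 ≤ Rm := by linarith
  have hsub : Set.range xf ⊆ X := hrange.le.trans Set.inter_subset_left
  have hxX : xf j ∈ X := hsub ⟨j, rfl⟩
  -- every atom of `X` within `Rm` of `xf j` is in the window
  have hwin : ∀ y ∈ X, dist y (xf j) ≤ Rm → y ∈ Set.range xf := by
    intro y hy hyd
    rw [hrange]
    refine ⟨hy, mem_closedBall_zero_iff.2 ?_⟩
    have h1 : ‖y‖ ≤ ‖xf j‖ + dist y (xf j) := by
      rw [dist_eq_norm]
      have := norm_add_le (xf j) (y - xf j)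
      rwa [add_sub_cancel] at this
    linarith
  -- the local window `A` and the removed singleton `S₀`
  set A : Set E3 := Set.range xf ∩ closedBall (xf j) Rm with hA
  have hAX : A ⊆ X := fun y hy => hsub hy.1
  have hxA : xf j ∈ A := ⟨⟨j, rfl⟩, mem_closedBall_self hRm0⟩
  -- Sütő's inequality for removing `xf j` and adding `p`
  set x₁ : Fin 1 → E3 := fun _ => xf j with hx₁
  set p₁ : Fin 1 → E3 := fun _ => p with hp₁
  have hx₁r : Set.range x₁ = {xf j} := by rw [hx₁, Set.range_const]
  have hx₁inj : Function.Injective x₁ := Function.injective_of_subsingleton _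
  have hp₁inj : Function.Injective p₁ := Function.injective_of_subsingleton _
  have hx₁X : Set.range x₁ ⊆ X := by rw [hx₁r]; exact Set.singleton_subset_iff.2 hxX
  have hdisj : Disjoint (Set.range p₁) (X \ Set.range x₁) := by
    rw [hx₁r, hp₁, Set.range_const, Set.disjoint_singleton_left]
    rintro ⟨hpX, hpx⟩
    have h7 := hsep p hpX (xf j) hxX (fun h => hpx (Set.mem_singleton_iff.2 h))
    linarith
  have key := hGSC.le hx₁inj hx₁X hp₁inj hdisj
  simp only [interactionEnergy_fin_one, Fin.sum_univ_one, hx₁, hp₁] at key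
  rw [Set.range_const] at key
  -- split both fields at the window `A` (`{xf j} ⊆ A ⊆ X`)
  have hSA : ({xf j} : Set E3) ⊆ A := Set.singleton_subset_iff.2 hxA
  rw [tsum_sdiff_split hGSC.summable hAX hSA (xf j), tsum_sdiff_split hGSC.summable hAX hSA p] at key
  -- the near parts are the local sums of the flag
  have hnear : ∀ q : E3, ∑' y : ↥(A \ {xf j}), lennardJones (dist q y) =
      ∑ k ∈ (Finset.univ.erase j).filter (fun k => dist (xf k) (xf j) ≤ Rm), lennardJones (dist q (xf k)) :=
    fun q => tsum_range_ball_diff_singleton_eq hinj j (xf j) Rm (fun y => lennardJones (dist q y))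
  rw [hnear (xf j), hnear p] at key
  -- the far parts differ by at most the dipole allowance
  have hfarR : ∀ y ∈ X \ A, Rm ≤ dist y (xf j) := by
    intro y hy
    by_contra hlt'
    exact hy.2 ⟨hwin y hy.1 (not_le.1 hlt').le, mem_closedBall.2 (not_le.1 hlt').le⟩
  have hBX : X \ A ⊆ X := fun y hy => hy.1
  have h1 : Summable fun y : ↥(X \ A) => lennardJones (dist p y) :=
    summable_of_subset (f := fun y => lennardJones (dist p y)) (hGSC.summable p) hBX
  have h2 : Summable fun y : ↥(X \ A) => lennardJones (dist (xf j) y) :=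
    summable_of_subset (f := fun y => lennardJones (dist (xf j) y)) (hGSC.summable (xf j)) hBX
  have hfar := tsum_far_move_sub_le (B := X \ A) hsep hGSC.summable hBX hps hRm1 hfarR
  rw [h1.tsum_sub h2] at hfar
  linarith

/-! ## §3. The cluster exemption `Ex₀ = sharp-move₀ ∨ LocOptFails(ε_E)`, the E-side transport and the two-slot transfer -/

/-- `Eopt-raw` is monotone in the exemption: a LARGER cluster exemption gives a WEAKER E-side hypothesis (`0 ≤ D_X`). [folklore] -/
theorem schurElasticPricingX_mono_ex {η₀ η₁ : ℝ} {w ω : ℝ → ℝ} {A eUp κE CE DE DX : ℝ} {Ex Ex' : SitePred}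
    (himp : ∀ (N : ℕ) (y : Fin N → E3) (i : Fin N), Ex N y i → Ex' N y i) (hDX : 0 ≤ DX)
    (h : SchurElasticPricingX η₀ η₁ w ω A eUp κE CE DE DX Ex) : SchurElasticPricingX η₀ η₁ w ω A eUp κE CE DE DX Ex' := by
  intro N y hy hsep
  have h1 := h N y hy hsep
  have hcard : (Nat.card {i : Fin N // Ex N y i} : ℝ) ≤ Nat.card {i : Fin N // Ex' N y i} := by
    rw [Nat.card_eq_fintype_card, Nat.card_eq_fintype_card, Fintype.card_subtype, Fintype.card_subtype]
    exact_mod_cast Finset.card_le_card fun i hi => by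
      simp only [Finset.mem_filter, Finset.mem_univ, true_and] at hi ⊢
      exact himp N y i hi
  nlinarith [mul_le_mul_of_nonneg_left hcard hDX]

/-- ★ **The cluster exemption of the zero-tolerance line is deep-absent**: `Ex₀ = (∃ s ∈ [0,S], MoveUnstableCore 0 Rm s) ∨ LocOptFails e⋆ ε_E ϱ′ 1`
(`1 + S ≤ Rm`, `0 < ε_E`), at depth `max Rm (locOptDepth ε_E ϱ′ 1)`. [folklore chaining] -/
theorem deepAbsent_ex_zero {Rm S εE ϱ' : ℝ} (hRmS : 1 + S ≤ Rm) (hεE : 0 < εE) :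
    DeepAbsent (max Rm (FrustratedLawDichotomyExemptLocOpt.locOptDepth εE ϱ' 1))
      (fun N y j => (∃ s : ℝ, 0 ≤ s ∧ s ≤ S ∧ MoveUnstableCore 0 Rm s N y j) ∨ LocOptFails eStar εE ϱ' 1 N y j) :=
  (deepAbsent_moveUnstableCore_union_zero hRmS).or (deepAbsent_locOptFails hεE)

/-- ★ **Two-slot transfer of the zero-tolerance motif predicate** `ExM∪T₀ = (∃ s ∈ [0,S], NonEquilibriumCore eUp 0 Rm s t) ∨ capped-tight`:
on a `7/10`-separated cluster it implies `Ex₀ ∨ GoodAt(1/20)` (`e⋆ ≤ eUp`, `ε_E ≤ t`, `0 ≤ ϱ′`, `1 ≤ Rm`; the MOVE branch needs nothing). [folklore] -/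
theorem unionTight_zero_transfer {eUp Rm t S D εE ϱ' : ℝ} (hUp : eStar ≤ eUp) (hεt : εE ≤ t) (hϱ' : 0 ≤ ϱ') (hRm : 1 ≤ Rm)
    (N : ℕ) (y : Fin N → E3) (_hy : Function.Injective y) (hsep : Sep y) (j : Fin N)
    (h : (∃ s : ℝ, 0 ≤ s ∧ s ≤ S ∧ NonEquilibriumCore eUp 0 Rm s t N y j) ∨ GoodAtScale (1 / 20) D y j) :
    ((∃ s : ℝ, 0 ≤ s ∧ s ≤ S ∧ MoveUnstableCore 0 Rm s N y j) ∨ LocOptFails eStar εE ϱ' 1 N y j) ∨ GoodAt (1 / 20) y j := by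
  rcases h with ⟨s, hs0, hsS, hm | hr⟩ | hg
  · exact Or.inl (Or.inl ⟨s, hs0, hsS, hm⟩)
  · exact Or.inl (Or.inr (locOptFails_of_removalUnstableCore hUp hεt hϱ' hRm hsep hr))
  · exact Or.inr hg.goodAt

/-- ★★ **THE ZERO-TOLERANCE TIGHT-COLLAR NODE** (record range data; levies and geometry as parameters; T-side move tolerance `0`, removal
tolerance `t ≥ ε_E`, E-side tolerance `ε_E > 0`; `1 + S ≤ Rm ≤ ρ₁`, `13/10·D + 1 ≤ ρ₁`, `0 ≤ ϱ′`):
`MuEquilibriumDoor ∧ UP ∧ Eopt-raw(κ_E; LocOptFails e⋆ ε_E ϱ′ 1) ∧ EquilibriumMotifPricingCapK κ_T ρ ϱ D W₄₅ e₄₅′ (Collar r ExM∪T₀) ⟹ crux`. [folklore chaining] -/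
theorem aperiodicFrustratedLawGap_of_collarMotifCapKK_unionT_zero {κT κE ρ r ρ₁ ϱ D εE Rm t S ϱ' CE DE DX : ℝ}
    (hDoor : Summit.AtomisticToContinuum.Crystallization.Theses.GrainCoreNetworkSplit.MuEquilibriumDoor)
    (hU : PeriodicEnergyCeiling (-(7175 / 10000))) (hεE : 0 < εE) (hDX : 0 ≤ DX) (hκE : 0 < κE)
    (hE : SchurElasticPricingX (1 / 20) (1 / 8) w₄₅ ω₄ (3 / 400) (-(7175 / 10000)) κE CE DE DX (LocOptFails eStar εE ϱ' 1))
    (hκ0 : 0 < κT) (hκ1 : κT ≤ 1) (h0 : 0 ≤ ρ) (hr : 0 ≤ r) (h1 : 0 ≤ ρ₁) (hρ : ρ ≤ ρ₁ + r) (hR : 9 / 2 ≤ ρ₁ + r)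
    (hD : 13 / 10 * D + 1 ≤ ρ₁) (hRm : Rm ≤ ρ₁) (hϱ : ρ + (ρ₁ + r) ≤ ϱ) (hRm1 : 1 + S ≤ Rm) (hS0 : 0 ≤ S) (hϱ' : 0 ≤ ϱ') (hεt : εE ≤ t)
    (h : EquilibriumMotifPricingCapK κT ρ ϱ D (effPot w₄₅ ω₄ (3 / 400)) (-(7175 / 10000) + 3 / 400)
      (Collar r fun N y j => (∃ s : ℝ, 0 ≤ s ∧ s ≤ S ∧ NonEquilibriumCore (-(7175 / 10000)) 0 Rm s t N y j) ∨ GoodAtScale (1 / 20) D y j)) :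
    Summit.AtomisticToContinuum.Crystallization.Theses.FrustratedLawDichotomy.AperiodicFrustratedLawGap :=
  aperiodicFrustratedLawGap_of_collarMotifCapKK_exMT hDoor sf₄₅_holds W₄₅_cutBounds (fun _ hu => effPot_fourHalf_eq_zero _ hu) hU
    (deepAbsent_ex_zero (ϱ' := ϱ') hRm1 hεE) hDX hκE (schurElasticPricingX_mono_ex (fun _ _ _ hx => Or.inr hx) hDX hE) hκ0 hκ1 h0 hr h1 hρ
    hR (hD.trans (le_add_of_nonneg_right hr)) hϱ (flag_unionTight_isLocal hRm hD)
    (unionTight_zero_transfer (eStar_le_of_periodicEnergyCeiling hU) hεt hϱ' (by linarith)) h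

/-- ★ **Periodic sibling (27624) of the zero-tolerance tight-collar node.** [folklore chaining] -/
theorem periodicFrustratedLawGap_of_collarMotifCapKK_unionT_zero {κT κE ρ r ρ₁ ϱ D εE Rm t S ϱ' CE DE DX : ℝ}
    (hDoor : Summit.AtomisticToContinuum.Crystallization.Theses.GrainCoreNetworkSplit.MuEquilibriumDoor)
    (hU : PeriodicEnergyCeiling (-(7175 / 10000))) (hεE : 0 < εE) (hDX : 0 ≤ DX) (hκE : 0 < κE)
    (hE : SchurElasticPricingX (1 / 20) (1 / 8) w₄₅ ω₄ (3 / 400) (-(7175 / 10000)) κE CE DE DX (LocOptFails eStar εE ϱ' 1))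
    (hκ0 : 0 < κT) (hκ1 : κT ≤ 1) (h0 : 0 ≤ ρ) (hr : 0 ≤ r) (h1 : 0 ≤ ρ₁) (hρ : ρ ≤ ρ₁ + r) (hR : 9 / 2 ≤ ρ₁ + r)
    (hD : 13 / 10 * D + 1 ≤ ρ₁) (hRm : Rm ≤ ρ₁) (hϱ : ρ + (ρ₁ + r) ≤ ϱ) (hRm1 : 1 + S ≤ Rm) (hS0 : 0 ≤ S) (hϱ' : 0 ≤ ϱ') (hεt : εE ≤ t)
    (h : EquilibriumMotifPricingCapK κT ρ ϱ D (effPot w₄₅ ω₄ (3 / 400)) (-(7175 / 10000) + 3 / 400)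
      (Collar r fun N y j => (∃ s : ℝ, 0 ≤ s ∧ s ≤ S ∧ NonEquilibriumCore (-(7175 / 10000)) 0 Rm s t N y j) ∨ GoodAtScale (1 / 20) D y j)) :
    Summit.AtomisticToContinuum.Crystallization.Theses.FrustratedLawDichotomy.PeriodicFrustratedLawGap :=
  periodicFrustratedLawGap_of_collarMotifCapKK_exMT hDoor sf₄₅_holds W₄₅_cutBounds (fun _ hu => effPot_fourHalf_eq_zero _ hu) hU
    (deepAbsent_ex_zero (ϱ' := ϱ') hRm1 hεE) hDX hκE (schurElasticPricingX_mono_ex (fun _ _ _ hx => Or.inr hx) hDX hE) hκ0 hκ1 h0 hr h1 hρ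
    hR (hD.trans (le_add_of_nonneg_right hr)) hϱ (flag_unionTight_isLocal hRm hD)
    (unionTight_zero_transfer (eStar_le_of_periodicEnergyCeiling hU) hεt hϱ' (by linarith)) h

/-! ## §4. The zero-tolerance leaf line at the literals of record, and the transfer from the ε-family -/

/-- ★★★ **THE ZERO-TOLERANCE TIGHT-COLLAR LEAF LINE** (door-free; levies `1/1000`, `1/10000`; record geometry; T-side exemption
`ExM∪T₀ = Collar (9/2) ((∃ s ∈ [0,3/2], NonEquilibriumCore (−0.7175) 0 7 s 10⁻⁴) ∨ GoodAtScale (1/20) (3/2))` — move tolerance ZERO (union-clean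
force cap `σ′(7) ≈ 0.0108`), removal tolerance `10⁻⁴`; E-side tolerance `ε_E ∈ (0, 10⁻⁴]` free):
`UP(−0.7175) ∧ 0 ≤ D_X ∧ Eopt-raw(1/10000; LocOptFails e⋆ ε_E (3/2) 1) ∧ F1X∪T₀ ∧ CC∪T₀ ∧ DD∪T₀ ⟹ AperiodicFrustratedLawGap` — the `ε → 0⁺` endpoint
of the line of record `…Tight.…_milli_unionT_eps`, now a theorem. [folklore instantiation] -/
theorem aperiodicFrustratedLawGap_of_collarPiecesKK_milli_unionT_zero {εE CE DE DX : ℝ} (hε0 : 0 < εE) (hε1 : εE ≤ 1 / 10000)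
    (hU : PeriodicEnergyCeiling (-(7175 / 10000))) (hDX : 0 ≤ DX)
    (hE : SchurElasticPricingX (1 / 20) (1 / 8) w₄₅ ω₄ (3 / 400) (-(7175 / 10000)) (1 / 10000) CE DE DX (LocOptFails eStar εE (3 / 2) 1))
    (h1 : StrainedPatchMotifPricingCapXK (1 / 1000) (9 / 5) (133 / 10) (3 / 2) (effPot w₄₅ ω₄ (3 / 400)) (-(7175 / 10000) + 3 / 400)
      (Collar (9 / 2) fun N y j => (∃ s : ℝ, 0 ≤ s ∧ s ≤ 3 / 2 ∧ NonEquilibriumCore (-(7175 / 10000)) 0 7 s (1 / 10000) N y j) ∨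
        GoodAtScale (1 / 20) (3 / 2) y j))
    (h2 : CrowdedCoreMotifPricingCapK (1 / 1000) (9 / 5) (133 / 10) (3 / 2) (effPot w₄₅ ω₄ (3 / 400)) (-(7175 / 10000) + 3 / 400)
      (Collar (9 / 2) fun N y j => (∃ s : ℝ, 0 ≤ s ∧ s ≤ 3 / 2 ∧ NonEquilibriumCore (-(7175 / 10000)) 0 7 s (1 / 10000) N y j) ∨
        GoodAtScale (1 / 20) (3 / 2) y j))
    (h3 : DiluteDefectMotifPricingCapK (1 / 1000) (9 / 5) (133 / 10) (3 / 2) (effPot w₄₅ ω₄ (3 / 400)) (-(7175 / 10000) + 3 / 400)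
      (Collar (9 / 2) fun N y j => (∃ s : ℝ, 0 ≤ s ∧ s ≤ 3 / 2 ∧ NonEquilibriumCore (-(7175 / 10000)) 0 7 s (1 / 10000) N y j) ∨
        GoodAtScale (1 / 20) (3 / 2) y j)) :
    Summit.AtomisticToContinuum.Crystallization.Theses.FrustratedLawDichotomy.AperiodicFrustratedLawGap :=
  aperiodicFrustratedLawGap_of_collarMotifCapKK_unionT_zero (ρ₁ := 7) muEquilibriumDoor hU hε0 hDX (by norm_num) hE (by norm_num)
    (by norm_num) (by norm_num) (by norm_num) (by norm_num) (by norm_num) (by norm_num) (by norm_num) le_rfl (by norm_num) (by norm_num)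
    (by norm_num) (by norm_num) hε1 (equilibriumMotifPricingCapK_iff_pieces.2 ⟨h1, h2, h3⟩)

/-- ★★ **Periodic sibling (27624), zero-tolerance tight-collar leaf line, door-free.** [folklore instantiation] -/
theorem periodicFrustratedLawGap_of_collarPiecesKK_milli_unionT_zero {εE CE DE DX : ℝ} (hε0 : 0 < εE) (hε1 : εE ≤ 1 / 10000)
    (hU : PeriodicEnergyCeiling (-(7175 / 10000))) (hDX : 0 ≤ DX)
    (hE : SchurElasticPricingX (1 / 20) (1 / 8) w₄₅ ω₄ (3 / 400) (-(7175 / 10000)) (1 / 10000) CE DE DX (LocOptFails eStar εE (3 / 2) 1))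
    (h1 : StrainedPatchMotifPricingCapXK (1 / 1000) (9 / 5) (133 / 10) (3 / 2) (effPot w₄₅ ω₄ (3 / 400)) (-(7175 / 10000) + 3 / 400)
      (Collar (9 / 2) fun N y j => (∃ s : ℝ, 0 ≤ s ∧ s ≤ 3 / 2 ∧ NonEquilibriumCore (-(7175 / 10000)) 0 7 s (1 / 10000) N y j) ∨
        GoodAtScale (1 / 20) (3 / 2) y j))
    (h2 : CrowdedCoreMotifPricingCapK (1 / 1000) (9 / 5) (133 / 10) (3 / 2) (effPot w₄₅ ω₄ (3 / 400)) (-(7175 / 10000) + 3 / 400)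
      (Collar (9 / 2) fun N y j => (∃ s : ℝ, 0 ≤ s ∧ s ≤ 3 / 2 ∧ NonEquilibriumCore (-(7175 / 10000)) 0 7 s (1 / 10000) N y j) ∨
        GoodAtScale (1 / 20) (3 / 2) y j))
    (h3 : DiluteDefectMotifPricingCapK (1 / 1000) (9 / 5) (133 / 10) (3 / 2) (effPot w₄₅ ω₄ (3 / 400)) (-(7175 / 10000) + 3 / 400)
      (Collar (9 / 2) fun N y j => (∃ s : ℝ, 0 ≤ s ∧ s ≤ 3 / 2 ∧ NonEquilibriumCore (-(7175 / 10000)) 0 7 s (1 / 10000) N y j) ∨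
        GoodAtScale (1 / 20) (3 / 2) y j)) :
    Summit.AtomisticToContinuum.Crystallization.Theses.FrustratedLawDichotomy.PeriodicFrustratedLawGap :=
  periodicFrustratedLawGap_of_collarMotifCapKK_unionT_zero (ρ₁ := 7) muEquilibriumDoor hU hε0 hDX (by norm_num) hE (by norm_num)
    (by norm_num) (by norm_num) (by norm_num) (by norm_num) (by norm_num) (by norm_num) (by norm_num) le_rfl (by norm_num) (by norm_num)
    (by norm_num) (by norm_num) hε1 (equilibriumMotifPricingCapK_iff_pieces.2 ⟨h1, h2, h3⟩)

/-- ★ **TRANSFER FROM EVERY MEMBER OF THE ε-FAMILY**: the three pieces at `ExM∪T(ε)` (any `ε ≥ 0`, any levy/geometry/potential) imply the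
three pieces at `ExM∪T₀` — every certificate for `…Tight.…_milli_unionT_eps (ε := …)` feeds the zero-tolerance line. [folklore] -/
theorem collarPiecesKK_unionT_zero_of_eps {κT ρ ϱ D r eUp ε Rm t S D' : ℝ} {W : ℝ → ℝ} {e : ℝ} (hε : 0 ≤ ε)
    (h1 : StrainedPatchMotifPricingCapXK κT ρ ϱ D W e
      (Collar r fun N y j => (∃ s : ℝ, 0 ≤ s ∧ s ≤ S ∧ NonEquilibriumCore eUp ε Rm s t N y j) ∨ GoodAtScale (1 / 20) D' y j))
    (h2 : CrowdedCoreMotifPricingCapK κT ρ ϱ D W e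
      (Collar r fun N y j => (∃ s : ℝ, 0 ≤ s ∧ s ≤ S ∧ NonEquilibriumCore eUp ε Rm s t N y j) ∨ GoodAtScale (1 / 20) D' y j))
    (h3 : DiluteDefectMotifPricingCapK κT ρ ϱ D W e
      (Collar r fun N y j => (∃ s : ℝ, 0 ≤ s ∧ s ≤ S ∧ NonEquilibriumCore eUp ε Rm s t N y j) ∨ GoodAtScale (1 / 20) D' y j)) :
    StrainedPatchMotifPricingCapXK κT ρ ϱ D W e
        (Collar r fun N y j => (∃ s : ℝ, 0 ≤ s ∧ s ≤ S ∧ NonEquilibriumCore eUp 0 Rm s t N y j) ∨ GoodAtScale (1 / 20) D' y j) ∧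
      CrowdedCoreMotifPricingCapK κT ρ ϱ D W e
        (Collar r fun N y j => (∃ s : ℝ, 0 ≤ s ∧ s ≤ S ∧ NonEquilibriumCore eUp 0 Rm s t N y j) ∨ GoodAtScale (1 / 20) D' y j) ∧
      DiluteDefectMotifPricingCapK κT ρ ϱ D W e
        (Collar r fun N y j => (∃ s : ℝ, 0 ≤ s ∧ s ≤ S ∧ NonEquilibriumCore eUp 0 Rm s t N y j) ∨ GoodAtScale (1 / 20) D' y j) :=
  have himp : ∀ (N : ℕ) (y : Fin N → E3) (j : Fin N),
      (Collar r fun N y j => (∃ s : ℝ, 0 ≤ s ∧ s ≤ S ∧ NonEquilibriumCore eUp ε Rm s t N y j) ∨ GoodAtScale (1 / 20) D' y j) N y j →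
      (Collar r fun N y j => (∃ s : ℝ, 0 ≤ s ∧ s ≤ S ∧ NonEquilibriumCore eUp 0 Rm s t N y j) ∨ GoodAtScale (1 / 20) D' y j) N y j :=
    fun _ _ _ => Collar.mono fun N y j h =>
      h.imp (FrustratedLawDichotomyCollarCensusUnionSharp.nonEquilibriumCore_union_mono_tol hε le_rfl N y j) id
  ⟨strainedPatchMotifPricingCapXK_anti_exM himp h1, crowdedCoreMotifPricingCapK_anti_exM himp h2, diluteDefectMotifPricingCapK_anti_exM himp h3⟩

end Summit.AtomisticToContinuum.Crystallization.Theorems.FrustratedLawDichotomyCollarCensusZero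

end
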